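import Literature.AlgebraicGeometry.Hyperkaehler.K3HilbertTypeMonodromy
import Literature.AlgebraicGeometry.Hyperkaehler.IrreducibleSymplecticOddCohomology
import Literature.AlgebraicGeometry.HodgeTheory.AlgebraicClasses
import Literature.AlgebraicGeometry.Surfaces.K3PeriodSurjectivityProofs
import Literature.AlgebraicTopology.SingularHomology.CupProductProofs
import Mathlib.LinearAlgebra.Matrix.NonsingularInverse
import Mathlib.LinearAlgebra.Matrix.Trace
import Mathlib.Tactic.Module
import Mathlib.Tactic.LinearCombination
import HarnessLib

/-!
# The cohomology of a `K3^{[2]}`-type fourfold: `H⁴ = Sym² H²` (Verbitsky–Guan), the polarised Fujiki relation and O'Grady's dual Beauville–Bogomolov class `q^∨ = (5/6) c₂` — PROVED identities, DEFINITIONS (`q^∨`, the `Sym²` basis), 3 NAMED FACTS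

Layer `Literature/AlgebraicGeometry/Hyperkaehler`.  Typed at the cross-ladder literature-typing seat
littype-FH1-1 (g2; home `run/shared/lean/pub/hodge-nonav/`) for the CONSUMER
`Summit.HodgeConjecture.HodgeConjecture.Theses.MarkmanPartnerTransport` (route
`route-HodgeConjecture-MarkmanPartnerTransport`, § DEFINITION REQUESTS: "F-V `VerbitskyGuan_H4_eq_symSq_H2`
(∀ marked K3^[2]-type X, Sym² H²(X(ℂ);ℂ) → H⁴ is a linear isomorphism …), F-O O'Grady dual BBF class
algebraic", and § NOT DECOMPOSED YET: "S-F polarised Fujiki relation (pure algebra from (m3))"; cruxes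
`PartnerTransport` / `IsometrySpannedThird`: "needs H⁴ = Sym² H² (Verbitsky–Guan, not yet a tree fact)
and O'Grady's dual class q^∨ algebraic — not yet tree facts").  One file = one source section: §4
"Generalities on IHS manifolds of K3^[2]-type" of Novario (Props. 4.1–4.4, which restate O'Grady 2008 §2
and §3 and Guan 2001 / Verbitsky 1996).

## Sources (READ at this seat; locators = pages / chunks of the materialised texts)

* S. Novario, *Hodge classes of type (2,2) on Hilbert squares of projective K3 surfaces*, Kyoto J. Math.
  66 (2026) no. 1 (arXiv:2112.11306) [`Novario2026HodgeClassesHilbertSquares`; REFEREED; held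
  `paper:novario2025-hodge-classes-type-2-2-hilbert-squares`, p. 4 = `p0004`], verbatim:
  "**Proposition 4.1.** Let `X` be an IHS manifold of dimension 4. Then `b₂(X) ≤ 23`. If equality holds
  then `b₃(X) = 0` and the map `Sym² H²(X, ℚ) → H⁴(X, ℚ)` induced by the cup product is an isomorphism. In
  particular this happens when `X` is an IHS fourfold of K3^[2]-type." (stated as "the following corollary
  of Verbitsky's results in [Ver96], obtained by Guan in [Gua01], see also [O'G10, Corollary 2.5]");
  "**Proposition 4.2 (O'Grady).** Let `X` be an IHS fourfold of K3^[2]-type. The intersection pairing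
  `⟨·,·⟩` defined above coincides with the bilinear form on `Sym² H²(X, ℚ)` given by
  `⟨α₁α₂, α₃α₄⟩ = (α₁,α₂)(α₃,α₄) + (α₁,α₃)(α₂,α₄) + (α₁,α₄)(α₂,α₃)` for every `α₁,…,α₄ ∈ H²(X, ℚ)`, where
  `(·,·)` denotes the BBF bilinear form on `H²(X, ℚ)`."; then "`q_X = Σ gᵢⱼ eᵢ^∨ ⊗ eⱼ^∨`,
  `q_X^∨ = Σ mᵢⱼ eᵢeⱼ`, where `gᵢⱼ := (eᵢ,eⱼ)`, […] `(mᵢⱼ) = (gᵢⱼ)⁻¹`"; "**Proposition 4.3 (O'Grady).**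
  Let `X` be an IHS fourfold of K3^[2]-type. […] Then `⟨·,·⟩` is non-degenerate and
  `⟨q_X^∨, αβ⟩ = 25(α,β)` for all `α, β ∈ H²(X, ℚ)`, `⟨q_X^∨, q_X^∨⟩ = 23 · 25`."; "O'Grady has shown in
  [O'G08, §3] that `q_X^∨` is a rational multiple of `c₂(X)`, the second Chern class of the tangent bundle of
  `X`, in particular it is an element of `H^{2,2}(X, ℚ)` […] **Proposition 4.4 (O'Grady).** Let `X` be an
  IHS fourfold of K3^[2]-type. Then `q_X^∨ ∈ H^{2,2}(X, ℚ)`, i.e., `q_X^∨` is a rational Hodge class of `X`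
  of type `(2,2)`, and `(6/5) q_X^∨ = c₂(X) ∈ H^{2,2}(X, ℤ)`. Moreover, `(2/5) q_X^∨ ∈ H^{2,2}(X, ℤ)` is an
  integral Hodge class of `X` of type `(2,2)`."
* K. G. O'Grady, *Irreducible symplectic 4-folds numerically equivalent to (K3)^[2]*, Commun. Contemp.
  Math. 10 (2008) 553–608 (arXiv:math/0504434) [`OGrady2008NumericalK3Square`; REFEREED; held
  `paper:arxiv-math_0504434`; theorem/equation numbers below are the arXiv text's — Novario cites the
  journal version as "[O'G08, Remark 2.1]" (pairing on `Sym²`), "[O'G08, Proposition 2.2]" (`⟨q^∨, α⟩`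
  computed from the BBF form) and "[O'G08, §3]" (`q^∨ ∈ ℚ c₂(X)`)]: §2.1 (p0004) "In particular `b₂(M) = 23`;
  as is well-known — see [Guan, Verbitsky] — this implies that **(2.1.4)** `H³(M;ℚ) = 0`,
  `Sym² H²(M;ℚ) ⥲ H⁴(M;ℚ)`, where the second isomorphism is given by cup-product"; §2.2 Remark 2.1 (p0004)
  "Let `M` be a numerical `(K3)^[2]`. The intersection form on `Sym² H²(M) ≅ H⁴(M)` is the bilinear form
  constructed as above" (`⟨α₁α₂,α₃α₄⟩ = (α₁,α₂)(α₃,α₄)+(α₁,α₃)(α₂,α₄)+(α₁,α₄)(α₂,α₃)`, "Using [Fujiki's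
  relation `∫α⁴ = 3(α,α)²`]"); §3 (p0005) the dual form
  "`q^∨ := Π₂ ∘ Sym₂(L_q⁻¹)(q) ∈ Sym² H²(X)`. Explicitly: […] `q^∨ = Σᵢⱼ mᵢⱼ αᵢαⱼ`, `(mᵢⱼ) = (gᵢⱼ)⁻¹`",
  Claim 3.1 and its proof "`⟨q^∨, αβ⟩ = 25(α,β)`, `α, β ∈ H²(X)`", "`⟨q^∨, q^∨⟩ = 25 · 23`", "`W(h)` is a sub
  Hodge structure because `q^∨` is rational of type `(2,2)`"; proof of Prop. 3.2 item (6) (p0007): "First we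
  show that `c₂(X) = 6q^∨/5` in `H⁴(X;ℚ)`. It is well-known that any `θ ∈ Sym² H²(X;ℚ) ∩ H^{2,2}(X)` which
  stays of type `(2,2)` for all deformations of `X` is a multiple of `q^∨` […] Applying
  Hirzebruch–Riemann–Roch […] `c₂(X)² = 828` […] `a = ±6/5` […] Since `2q^∨ ∈ Sym² H²(X;ℤ)` [this] gives
  `H⁴(X;ℤ)/Tors ∋ (2c₂(X) − 2q^∨) = 2q^∨/5 = c₂(X)/3`."  (A "numerical `(K3)^[2]`" is an irreducible
  symplectic fourfold `M` with `H²(M;ℤ) ≅ Λ = Λ_{K3} ⊕ ⟨−2⟩` and Fujiki constant `3`, §2.1 (2.1.2)–(2.1.3);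
  every fourfold of `K3^{[2]}`-type is one.)
* D. Guan, *On the Betti numbers of irreducible compact hyperkähler manifolds of complex dimension four*,
  Math. Res. Lett. 8 (2001) 663–669 [`Guan2001BettiNumbersHyperkaehlerFourfolds`; REFEREED; open-access
  text fetched, pp. 663–665], verbatim: "**Main Theorem.** If `M` is an irreducible compact hyperkähler
  manifold of complex dimension `4`, then `3 ≤ b₂ ≤ 23`. Moreover, 1. if `b₂ = 23`, then `b₃ = 0`. The Hodge
  diamond of `M` is the same as that of the Hilbert scheme of pairs of points on a K3 surface. […]"
  (p. 663–664); "**Theorem 1.** If `M` is an irreducible compact hyperkähler manifold of complex dimension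
  4, then `b₂ ≤ 23`. The maximum of `b₂` is achieved by `K^[2]`. And if `b₂ = 23` the Hodge diamond is the
  same as that of `K^[2]`." (p. 664; proof p. 665: "If `b₂ = 23`, then `b₄ ≥ 23 × 12 = 276`. Therefore,
  `b₃ + 276 ≤ 46 + 230`, i.e., `b₃ = 0`" — Salamon's relation, so `b₄ = 276`).
* M. Verbitsky, *Cohomology of compact hyperkähler manifolds and its applications*, GAFA 6 (1996)
  601–611 (alg-geom/9511009) [`Verbitsky1996CohomologyGAFA`; held `paper:arxiv-alg-geom_9511009` p0002]:
  "Let `H^*_r(M)` be a sub-algebra of `H^*(M)` generated by `H²(M)`. […] ([main], Theorem 15.2) Let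
  `dim_ℂ M = 2n`. Then `H^{2i}_r(M) ≅ Sⁱ H²(M)` for `i ≤ n`, and `H^{2i}_r(M) ≅ S^{2n-i} H²(M)` for `i ≥ n`"
  — for `n = 2`, `i = 2`: the cup product `Sym² H² → H⁴` is INJECTIVE; with `b₄ = 276 = dim Sym² ℚ²³` it is
  an isomorphism (this is how (2.1.4) and Prop. 4.1 combine [Guan] and [Verbitsky]).

## Rendering (tree carriers; the marked rendering of the consumer)

* `X : Motives.SchemeOver ℂ`, smooth projective of dimension `4` (`Motives.IsSmoothProjective 4 X`), of
  `K3^{[2]}`-type (`IsOfK3HilbertSquareType X`, file `K3HilbertType`); "IHS manifold of dimension 4" ↦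
  `IsProjectiveIrreducibleSymplectic 4 X` (file `OGradySixType`; the PROJECTIVE case of print — weaker than
  print, never stronger, as in `IrreducibleSymplecticOddCohomology`).
* `bₖ(X)` ↦ `Module.finrank ℂ (complexBetti X k)`; "`Sym² H² → H⁴` (cup product) is an isomorphism" ↦ the
  `ℂ`-span of `{a ∪ b}` is all of `H⁴(X(ℂ); ℂ)` AND `b₄ = 276 (= 23·24/2 = dim Sym² H²)`, `b₂ = 23`: a
  surjective linear map `Sym² H² → H⁴` between spaces of equal finite dimension is an isomorphism, so the
  conjunction is exactly the printed statement (complexified), with no `Sym²`-object needed on the carrier.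
* A Beauville–Bogomolov MARKING is the tree's `IsMarkedK3Hilb 2 X φ P` (file `K3HilbertTypeMonodromy`;
  = clauses (m1)–(m3) of the consumer's `MarkedK3Sq`: `P` an integral generator of `H⁸(X(ℂ);ℂ)`,
  `φ : H²(X(ℂ);ℂ) ≃ Λ ⊗ ℂ`, `Λ = k3HilbertGram 2 = Λ_{K3} ⊕ ⟨−2⟩`, identifying integral classes with `ℤ²³`,
  and the Fujiki relation `a⁴ = 3·q(φa)²·P`, `q = k3HilbertForm 2`).  (k1)–(k3) force `P` to be the
  positive generator `[X]` and `(a,b) ↦ q(φa,φb)` to be `±` the BBF form `q_X` (compare (k3) with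
  `a⁴ = 3 q_X(a)² [X]` on integral classes, where both forms are `ℤ`-valued, then use that `ℂ[H²]` is a
  domain); every identity and fact below is invariant under that sign, so no period clause is needed.
* "`⟨x, αβ⟩ = c`" for `x ∈ H⁴` ↦ `(x ∪ α) ∪ β = c • P` in `H⁸` (the consumer's spelling
  `cupProduct (rfl : 2*3+2 = 2*4) (cupProduct (rfl : 2*2+2 = 2*3) x α) β`); `⟨α₁α₂,α₃α₄⟩` ↦
  `cupFour α₁ α₂ α₃ α₄ := ((α₁ ∪ α₂) ∪ α₃) ∪ α₄`.
* O'Grady's `q^∨ = Σᵢⱼ mᵢⱼ αᵢαⱼ`, `(mᵢⱼ) = (gᵢⱼ)⁻¹` ↦ the DEFINITION `dualBBFClass n φ :=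
  Σᵢⱼ ((Λₙ ⊗ ℚ)⁻¹)ᵢⱼ • (φ⁻¹eᵢ ∪ φ⁻¹eⱼ) ∈ H⁴(X(ℂ);ℂ)` for the basis `αᵢ = φ⁻¹(eᵢ)` read through the marking
  (`gᵢⱼ = q(eᵢ,eⱼ) = (k3HilbertGram n)ᵢⱼ`; `det Λ₂ = 2`, so `m ∈ ½ℤ`).  Under the sign ambiguity above
  `dualBBFClass 2 φ = ± q_X^∨`.
* "`c₂(X)`": the tree has Chern classes on the real carrier only as the hypothesis structure
  `HodgeTheory.ChernCharacterBetti` (no tangent sheaf object); the relation `(6/5)q^∨ = c₂(X)` is therefore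
  NOT a clause — what is recorded is its printed CONSEQUENCE used by the consumer: `q^∨` is an ALGEBRAIC
  class (`c₂` of the tangent bundle of a smooth projective variety is algebraic, Fulton Prop. 19.1.2 — the
  field `ch_mem_algebraicClasses` of that structure) and `(2/5)q^∨` is an integral class.
  `-- TODO(general form): state (6/5)·q^∨ = c₂(T_X) once the tangent sheaf is an object of X.Modules.`

## Content and accounting (D-0026: +3 named facts, each a REFEREED published theorem; 1 definition; rest PROVED)

* PROVED (kernel): the polarised Fujiki relation `cupFour_eq_of_isMarkedK3Hilb` (O'Grady Remark 2.1 =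
  Novario Prop. 4.2) from clause (k3) ALONE, by polarisation of the quartic form `a ↦ a⁴` (abstract lemma
  `eq_zero_of_symmetric_of_diag_eq_zero`: a symmetric 4-linear map over a field of characteristic `0`
  vanishing on the diagonal vanishes); O'Grady's identities `⟨q^∨, αβ⟩ = 25(α,β)`
  (`dualBBFClass_cup_cup`) and `⟨q^∨, q^∨⟩ = 23·25` (`dualBBFClass_cup_self`) (Claim 3.1 / Novario
  Prop. 4.3) from the polarised relation and `m·g = 1`, `tr(m·g) = 23`; rationality of `q^∨`
  (`isRationalClass_dualBBFClass`).
* FACTS: `Guan2001_betti_irreducibleSymplecticFourfold` (Guan Main Thm + Thm. 1 with Verbitsky: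
  `3 ≤ b₂ ≤ 23`; `b₂ = 23 ⇒ b₃ = 0 ∧ b₄ = 276 ∧ H⁴ = H² ∪ H²`), `VerbitskyGuan_cohomology_K3HilbertSquareType`
  (Novario Prop. 4.1 "in particular" / O'Grady (2.1.4): `b₂ = 23, b₃ = 0, b₄ = 276, H⁴ = H² ∪ H²` for
  smooth projective `K3^{[2]}`-type fourfolds), `OGrady2008_dualBBFClass_algebraic` (O'Grady §3 (c₂ = 6q^∨/5,
  `2q^∨/5 ∈ H⁴(X;ℤ)/Tors`) / Novario Prop. 4.4: `q^∨` algebraic, `(2/5)q^∨` integral).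
* DERIVED for the consumer: `OGrady2008_dualBBFClass_algebraic.exists_cup_cup_eq` (F-O in the shape of
  ROUTE-P1D-Sketch §14b: an algebraic rational `qd` with `(qd ∪ a) ∪ b = 25·q(φa,φb)·P`), `b₅ = 0`, `b₆ = 23`
  (hard Lefschetz, tree theorem), and `H⁴ = Sym² H²` IN COORDINATES: `symSqBasis` /
  `VerbitskyGuan_cohomology_K3HilbertSquareType.symSqBasis` — the `276 = C(24,2)` classes `φ⁻¹eᵢ ∪ φ⁻¹eⱼ`,
  `{i,j} ∈ Sym²`, are a `Module.Basis` of `H⁴(X(ℂ);ℂ)` (span from bilinearity, independence by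
  `276` spanning vectors in dimension `276`, Mathlib `basisOfTopLeSpanOfCardEqFinrank`).
* The bilinearity / symmetry / `det` lemmas for `k3HilbertForm n` in §1 duplicate summit-side lemmas of
  `Summits/HodgeConjecture/HodgeConjecture/Theorems/NikulinTwinTransportTwinSimilitudeAlgebraicHKLatticeTransport.lean`
  and `…StubHkLatticeWittAux.lean` (same statements, `Summit.…NikulinTwinTransport.k3HilbertForm_add_left` etc.);
  they are restated here because `Literature/` cannot import `Summits/` (CONVENTIONS §2) and belong with
  the lattice (`K3HilbertType`).

NOT here: non-degeneracy of `⟨·,·⟩` on `Sym² H²` (Prop. 4.3, first clause; linear algebra on `Λ ⊗ ℚ`, not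
needed by the consumer); the Hodge numbers `h^{p,q}` of `K3^{[2]}` (Guan Thm. 1 "Hodge diamond"; needs a
Hodge model); `Sym³`, `Sym⁴` (Verbitsky for `i ≥ n`); the non-projective (compact hyperkähler) case; any
proof of the facts (Verbitsky's `so(4, b₂−2)`-action, Guan's Rozansky–Witten/Riemann–Roch bounds, O'Grady's
deformation argument and HRR — XL in the tree).
-/

noncomputable section

open CategoryTheory
open scoped Matrix

namespace Literature.AlgebraicGeometry.Hyperkaehler

open Literature.AlgebraicTopology.SingularHomology
open Literature.AlgebraicGeometry.HodgeTheory

/-! ### §0 Polarisation: a symmetric `4`-linear map is determined by its diagonal -/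

section Polarisation

variable {K V W : Type*} [Field K] [CharZero K] [AddCommGroup V] [Module K V] [AddCommGroup W]
  [Module K W]

/-- **Polarisation of quartic forms**: a map `T : V⁴ → W` of `K`-vector spaces (`char K = 0`) that is
linear in its first argument, symmetric under the three adjacent transpositions, and vanishes on the
diagonal (`T(a,a,a,a) = 0`) vanishes identically.  (Expand `T(a + t b)^{×4} = 0` for `t = 1, −1, 2` to
kill `T(a,a,a,b)`, `T(a,a,b,b)`, `T(a,b,b,b)`; then `T(a,a,b+c,b+c)` and `T(a+b,a+b,c,d)`.)  This is the
uniqueness half of "the unique symmetric bilinear form on `S²V` such that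
`⟨α₁α₂,α₃α₄⟩ = (α₁,α₂)(α₃,α₄)+(α₁,α₃)(α₂,α₄)+(α₁,α₄)(α₂,α₃)`" used in O'Grady's Remark 2.1.
[cite: OGrady2008NumericalK3Square, §2.2 and Remark 2.1] -/
theorem eq_zero_of_symmetric_of_diag_eq_zero (T : V → V → V → V → W)
    (hadd : ∀ a a' b c d, T (a + a') b c d = T a b c d + T a' b c d)
    (hsmul : ∀ (t : K) a b c d, T (t • a) b c d = t • T a b c d)
    (h12 : ∀ a b c d, T a b c d = T b a c d)
    (h23 : ∀ a b c d, T a b c d = T a c b d)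
    (h34 : ∀ a b c d, T a b c d = T a b d c)
    (hdiag : ∀ a, T a a a a = 0) (a b c d : V) : T a b c d = 0 := by
  -- additivity and homogeneity in every slot
  have hadd2 : ∀ a b b' c d, T a (b + b') c d = T a b c d + T a b' c d := fun a b b' c d ↦ by
    rw [← h12, hadd, h12, h12 b']
  have hadd3 : ∀ a b c c' d, T a b (c + c') d = T a b c d + T a b c' d := fun a b c c' d ↦ by
    rw [← h23, hadd2, h23, h23 a c']
  have hadd4 : ∀ a b c d d', T a b c (d + d') = T a b c d + T a b c d' := fun a b c d d' ↦ by
    rw [← h34, hadd3, h34, h34 a b d']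
  have hsmul2 : ∀ (t : K) a b c d, T a (t • b) c d = t • T a b c d := fun t a b c d ↦ by
    rw [← h12, hsmul, h12]
  have hsmul3 : ∀ (t : K) a b c d, T a b (t • c) d = t • T a b c d := fun t a b c d ↦ by
    rw [← h23, hsmul2, h23]
  have hsmul4 : ∀ (t : K) a b c d, T a b c (t • d) = t • T a b c d := fun t a b c d ↦ by
    rw [← h34, hsmul3, h34]
  -- Step 1: `T a a a b = T a a b b = T a b b b = 0`.
  have step1 : ∀ a b, T a a a b = 0 ∧ T a a b b = 0 ∧ T a b b b = 0 := by
    intro a b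
    have s1 : T a a b a = T a a a b := by rw [h34]
    have s2 : T a b a a = T a a a b := by rw [h23, h34]
    have s3 : T b a a a = T a a a b := by rw [h12, h23, h34]
    have s4 : T a b a b = T a a b b := by rw [h23]
    have s5 : T a b b a = T a a b b := by rw [h34, h23]
    have s6 : T b a a b = T a a b b := by rw [h12, h23]
    have s7 : T b a b a = T a a b b := by rw [h12, h34, h23]
    have s8 : T b b a a = T a a b b := by rw [h23, h12, h34, h23]
    have s9 : T b a b b = T a b b b := by rw [h12]
    have s10 : T b b a b = T a b b b := by rw [h23, h12]
    have s11 : T b b b a = T a b b b := by rw [h34, h23, h12]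
    have key : ∀ t : K,
        (4 * t) • T a a a b + (6 * t ^ 2) • T a a b b + (4 * t ^ 3) • T a b b b = 0 := by
      intro t
      have h := hdiag (a + t • b)
      simp only [hadd, hadd2, hadd3, hadd4, hsmul, hsmul2, hsmul3, hsmul4, hdiag, s1, s2, s3, s4, s5,
        s6, s7, s8, s9, s10, s11] at h
      rw [← h]
      module
    have hB : T a a b b = 0 := by
      have h : (12 : K) • T a a b b = 0 := by
        linear_combination (norm := module) key 1 + key (-1)
      exact (smul_eq_zero.mp h).resolve_left (by norm_num)
    have hC : T a b b b = 0 := by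
      have h : (24 : K) • T a b b b = 0 := by
        linear_combination (norm := module) key 2 - (3 : K) • key 1 - key (-1)
      exact (smul_eq_zero.mp h).resolve_left (by norm_num)
    have hA : T a a a b = 0 := by
      have h : (24 : K) • T a a a b = 0 := by
        linear_combination (norm := module) (6 : K) • key 1 - (2 : K) • key (-1) - key 2
      exact (smul_eq_zero.mp h).resolve_left (by norm_num)
    exact ⟨hA, hB, hC⟩
  -- Step 2: `T a a b c = 0`.
  have step2 : ∀ a b c, T a a b c = 0 := by
    intro a b c
    have h := (step1 a (b + c)).2.1
    rw [hadd3, hadd4, hadd4, (step1 a b).2.1, (step1 a c).2.1, zero_add, add_zero,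
      h34 a a c b, ← two_smul K] at h
    exact (smul_eq_zero.mp h).resolve_left (by norm_num)
  -- Step 3: the general case.
  have h := step2 (a + b) c d
  rw [hadd, hadd2, hadd2, step2 a c d, step2 b c d, zero_add, add_zero, h12 b a, ← two_smul K] at h
  exact (smul_eq_zero.mp h).resolve_left (by norm_num)

end Polarisation

/-! ### §1 The `K3^{[n]}` lattice form: bilinearity, Gram entries, determinant -/

/-- Additivity of the `K3^{[n]}` form in the first argument. [cite: Markman2024, §1.3 Step 1] -/
theorem k3HilbertForm_add_left (n : ℕ) (a a' b : K3HilbertIndex → ℂ) :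
    k3HilbertForm n (a + a') b = k3HilbertForm n a b + k3HilbertForm n a' b := by
  simp only [k3HilbertForm, Pi.add_apply, add_mul, Finset.sum_add_distrib]

/-- Homogeneity of the `K3^{[n]}` form in the first argument. [cite: Markman2024, §1.3 Step 1] -/
theorem k3HilbertForm_smul_left (n : ℕ) (t : ℂ) (a b : K3HilbertIndex → ℂ) :
    k3HilbertForm n (t • a) b = t * k3HilbertForm n a b := by
  simp only [k3HilbertForm, Pi.smul_apply, smul_eq_mul, mul_assoc, Finset.mul_sum]

/-- The Gram matrix of the `K3^{[n]}` lattice is symmetric, entrywise. [cite: Beauville1983, §9 Lemme 1] -/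
theorem k3HilbertGram_apply_comm (n : ℕ) (i j : K3HilbertIndex) :
    k3HilbertGram n i j = k3HilbertGram n j i := by
  rw [← Matrix.transpose_apply (k3HilbertGram n) j i, k3HilbertGram_transpose]

/-- The `K3^{[n]}` form is symmetric. [cite: Beauville1983, §9 Lemme 1] -/
theorem k3HilbertForm_comm (n : ℕ) (a b : K3HilbertIndex → ℂ) :
    k3HilbertForm n a b = k3HilbertForm n b a := by
  simp only [k3HilbertForm]
  rw [Finset.sum_comm]
  refine Finset.sum_congr rfl fun i _ => Finset.sum_congr rfl fun j _ => ?_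
  rw [k3HilbertGram_apply_comm n j i]
  ring

/-- Additivity of the `K3^{[n]}` form in the second argument. [cite: Markman2024, §1.3 Step 1] -/
theorem k3HilbertForm_add_right (n : ℕ) (a b b' : K3HilbertIndex → ℂ) :
    k3HilbertForm n a (b + b') = k3HilbertForm n a b + k3HilbertForm n a b' := by
  rw [k3HilbertForm_comm, k3HilbertForm_add_left, k3HilbertForm_comm n b, k3HilbertForm_comm n b']

/-- Homogeneity of the `K3^{[n]}` form in the second argument. [cite: Markman2024, §1.3 Step 1] -/
theorem k3HilbertForm_smul_right (n : ℕ) (t : ℂ) (a b : K3HilbertIndex → ℂ) :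
    k3HilbertForm n a (t • b) = t * k3HilbertForm n a b := by
  rw [k3HilbertForm_comm, k3HilbertForm_smul_left, k3HilbertForm_comm n b]

/-- The `K3^{[n]}` form in matrix terms: `(a.b) = a ⬝ᵥ (Λₙ *ᵥ b)`. [cite: Markman2024, §1.3 Step 1] -/
theorem k3HilbertForm_eq_dotProduct (n : ℕ) (a b : K3HilbertIndex → ℂ) :
    k3HilbertForm n a b = a ⬝ᵥ ((k3HilbertGram n).map (Int.cast : ℤ → ℂ) *ᵥ b) := by
  simp only [k3HilbertForm, dotProduct, Matrix.mulVec, Matrix.map_apply, Finset.mul_sum, mul_assoc]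

/-- On basis vectors the form is the Gram entry: `(eᵢ.eⱼ) = (Λₙ)ᵢⱼ`. [cite: Markman2024, §1.3 Step 1] -/
theorem k3HilbertForm_single_single (n : ℕ) (i j : K3HilbertIndex) :
    k3HilbertForm n (Pi.single i 1) (Pi.single j 1) = (k3HilbertGram n i j : ℂ) := by
  simp only [k3HilbertForm, Pi.single_apply, ite_mul, one_mul, zero_mul, mul_ite, mul_one, mul_zero,
    Finset.sum_ite_eq', Finset.mem_univ, if_true]

/-- Pairing with a basis vector is the matrix action: `(eᵢ.b) = (Λₙ b)ᵢ`. [cite: Markman2024, §1.3 Step 1] -/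
theorem k3HilbertForm_single_left (n : ℕ) (i : K3HilbertIndex) (b : K3HilbertIndex → ℂ) :
    k3HilbertForm n (Pi.single i 1) b = ((k3HilbertGram n).map (Int.cast : ℤ → ℂ) *ᵥ b) i := by
  rw [k3HilbertForm_eq_dotProduct, single_dotProduct, one_mul]

/-- `det(Λ_{K3} ⊕ ⟨2 − 2n⟩) = (−1)·(2 − 2n) = 2n − 2` (`Λ_{K3}` is unimodular of determinant `−1`,
tree theorem `Surfaces.k3Gram_det`); for `n = 2`: `det Λ = 2`, so `Λ^∨/Λ ≅ ℤ/2` and `Λ⁻¹ ∈ ½ M₂₃(ℤ)`.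
[cite: OGrady2008NumericalK3Square, §2.1 (2.1.2)] [cite: Beauville1983, §9 Remarque 1] -/
theorem k3HilbertGram_det (n : ℕ) : (k3HilbertGram n).det = 2 * (n : ℤ) - 2 := by
  rw [k3HilbertGram, Matrix.det_fromBlocks_zero₂₁, Surfaces.k3Gram_det, Matrix.det_unique,
    Matrix.of_apply]
  ring

/-- `det Λ₂ = 2` for the `K3^{[2]}` lattice `Λ_{K3} ⊕ ⟨−2⟩`. [cite: OGrady2008NumericalK3Square, §2.1 (2.1.2)] -/
theorem k3HilbertGram_two_det : (k3HilbertGram 2).det = 2 := by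
  rw [k3HilbertGram_det]; norm_num

/-! ### §2 The four-fold cup product `((a ∪ b) ∪ c) ∪ d` on a fourfold and its symmetries -/

section CupFour

variable {X : Motives.SchemeOver ℂ}

/-- `cupFour a b c d = ((a ∪ b) ∪ c) ∪ d ∈ H⁸(X(ℂ); ℂ)` for degree-`2` classes, in the degree spelling
`2+2 = 2·2`, `2·2+2 = 2·3`, `2·3+2 = 2·4` of the consumer (`MarkmanPartnerTransport`) and of `cupPowTwo`;
it is the integrand of O'Grady's pairing `⟨ab, cd⟩ = ∫ abcd` on `Sym² H²`.
[cite: OGrady2008NumericalK3Square, §2.2 Remark 2.1] -/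
def cupFour (a b c d : complexBetti X 2) : complexBetti X (2 * 4) :=
  cupProduct (rfl : 2 * 3 + 2 = 2 * 4)
    (cupProduct (rfl : 2 * 2 + 2 = 2 * 3) (cupProduct (rfl : 2 + 2 = 2 * 2) a b) c) d

/-- Unfolding of `cupFour`. [cite: OGrady2008NumericalK3Square, §2.2 Remark 2.1] -/
theorem cupFour_def (a b c d : complexBetti X 2) : cupFour a b c d =
    cupProduct (rfl : 2 * 3 + 2 = 2 * 4)
      (cupProduct (rfl : 2 * 2 + 2 = 2 * 3) (cupProduct (rfl : 2 + 2 = 2 * 2) a b) c) d := rfl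

/-- Degree-`2` classes commute: `a ∪ b = b ∪ a` (graded commutativity with sign `(−1)^{2·2} = 1`, tree
theorem `cupProduct_gradedComm_holds`). [cite: HatcherAT2002, §3.2 Thm. 3.11] -/
theorem cupProduct_two_two_comm (a b : complexBetti X 2) :
    cupProduct (rfl : 2 + 2 = 2 * 2) a b = cupProduct (rfl : 2 + 2 = 2 * 2) b a := by
  have h := cupProduct_gradedComm_holds ℂ (Motives.ComplexPoints X) (rfl : 2 + 2 = 2 * 2)
    (rfl : 2 + 2 = 2 * 2) a b
  rw [h]; norm_num

/-- `cupFour` is symmetric in its first two arguments. [cite: HatcherAT2002, §3.2 Thm. 3.11] -/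
theorem cupFour_swap12 (a b c d : complexBetti X 2) : cupFour a b c d = cupFour b a c d := by
  rw [cupFour, cupFour, cupProduct_two_two_comm a b]

/-- `cupFour` is symmetric in its middle arguments (associativity + graded commutativity).
[cite: HatcherAT2002, §3.2 Thm. 3.11 and p. 211 (associativity)] -/
theorem cupFour_swap23 (a b c d : complexBetti X 2) : cupFour a b c d = cupFour a c b d := by
  simp only [cupFour]
  congr 1
  rw [cupProduct_assoc (rfl : 2 + 2 = 2 * 2) (rfl : 2 + 2 = 2 * 2) (rfl : 2 * 2 + 2 = 2 * 3)
      (rfl : 2 + 2 * 2 = 2 * 3) a b c,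
    cupProduct_assoc (rfl : 2 + 2 = 2 * 2) (rfl : 2 + 2 = 2 * 2) (rfl : 2 * 2 + 2 = 2 * 3)
      (rfl : 2 + 2 * 2 = 2 * 3) a c b, cupProduct_two_two_comm b c]

/-- `cupFour` is symmetric in its last two arguments. [cite: HatcherAT2002, §3.2 Thm. 3.11 and p. 211] -/
theorem cupFour_swap34 (a b c d : complexBetti X 2) : cupFour a b c d = cupFour a b d c := by
  simp only [cupFour]
  rw [cupProduct_assoc (rfl : 2 * 2 + 2 = 2 * 3) (rfl : 2 + 2 = 2 * 2) (rfl : 2 * 3 + 2 = 2 * 4)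
      (rfl : 2 * 2 + 2 * 2 = 2 * 4) _ c d,
    cupProduct_assoc (rfl : 2 * 2 + 2 = 2 * 3) (rfl : 2 + 2 = 2 * 2) (rfl : 2 * 3 + 2 = 2 * 4)
      (rfl : 2 * 2 + 2 * 2 = 2 * 4) _ d c, cupProduct_two_two_comm c d]

/-- `cupFour` is additive in its first argument. [cite: HatcherAT2002, §3.2 p. 206 (bilinearity)] -/
theorem cupFour_add (a a' b c d : complexBetti X 2) :
    cupFour (a + a') b c d = cupFour a b c d + cupFour a' b c d := by
  simp only [cupFour, map_add, LinearMap.add_apply]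

/-- `cupFour` is homogeneous in its first argument. [cite: HatcherAT2002, §3.2 p. 206 (bilinearity)] -/
theorem cupFour_smul (t : ℂ) (a b c d : complexBetti X 2) :
    cupFour (t • a) b c d = t • cupFour a b c d := by
  simp only [cupFour, map_smul, LinearMap.smul_apply]

/-- The quartic cup power is the diagonal of `cupFour`: `a⁴ = ((a ∪ a) ∪ a) ∪ a`.
[cite: HatcherAT2002, §3.2] -/
theorem cupPowTwo_four (a : complexBetti X 2) : cupPowTwo a 4 = cupFour a a a a := by
  rw [cupPowTwo_succ, cupPowTwo_succ, cupPowTwo_succ, cupPowTwo_one]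
  rfl

/-! ### §3 The polarised Fujiki relation (O'Grady Remark 2.1 / Novario Prop. 4.2) — PROVED from (k3) -/

/-- **The polarised Fujiki relation on a marked `K3^{[2]}`-type fourfold (O'Grady 2008 Remark 2.1;
Novario Prop. 4.2): "The intersection pairing `⟨·,·⟩` [on `Sym² H²(X, ℚ) ≅ H⁴(X, ℚ)`] coincides with
the bilinear form given by `⟨α₁α₂, α₃α₄⟩ = (α₁,α₂)(α₃,α₄) + (α₁,α₃)(α₂,α₄) + (α₁,α₄)(α₂,α₃)`."**
Rendering: for every marking `IsMarkedK3Hilb 2 X φ P` (so `a⁴ = 3 q(φa)² P`, `q = k3HilbertForm 2`) and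
all `a b c d ∈ H²(X(ℂ); ℂ)`,
`((a ∪ b) ∪ c) ∪ d = (q(φa,φb) q(φc,φd) + q(φa,φc) q(φb,φd) + q(φa,φd) q(φb,φc)) • P`.
PROVED here (kernel) from the Fujiki clause (k3) alone by polarisation
(`eq_zero_of_symmetric_of_diag_eq_zero`): both sides are symmetric `4`-linear in `(a,b,c,d)` and agree on
the diagonal, `3q(a)² = q(a)q(a) + q(a)q(a) + q(a)q(a)`.  This is the route's support statement S-F
(`polarisedFujiki_K3Sq2Type` of ROUTE-P1D-Sketch §14b), now a theorem; no hypothesis on `X` beyond the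
marking is used. [cite: OGrady2008NumericalK3Square, §2.2 Remark 2.1]
[cite: Novario2026HodgeClassesHilbertSquares, Prop. 4.2 (p. 4)] -/
theorem cupFour_eq_of_isMarkedK3Hilb {φ : complexBetti X 2 ≃ₗ[ℂ] (K3HilbertIndex → ℂ)}
    {P : complexBetti X (2 * (2 * 2))} (h : IsMarkedK3Hilb 2 X φ P) (a b c d : complexBetti X 2) :
    cupFour a b c d =
      (k3HilbertForm 2 (φ a) (φ b) * k3HilbertForm 2 (φ c) (φ d) +
        k3HilbertForm 2 (φ a) (φ c) * k3HilbertForm 2 (φ b) (φ d) +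
        k3HilbertForm 2 (φ a) (φ d) * k3HilbertForm 2 (φ b) (φ c)) • P := by
  set B : complexBetti X 2 → complexBetti X 2 → ℂ := fun x y => k3HilbertForm 2 (φ x) (φ y) with hB
  have hBc : ∀ x y, B x y = B y x := fun x y => k3HilbertForm_comm 2 _ _
  have hBadd : ∀ x x' y, B (x + x') y = B x y + B x' y := fun x x' y => by
    simp only [hB, map_add, k3HilbertForm_add_left]
  have hBsmul : ∀ (t : ℂ) x y, B (t • x) y = t * B x y := fun t x y => by
    simp only [hB, map_smul, k3HilbertForm_smul_left]
  rw [← sub_eq_zero]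
  refine eq_zero_of_symmetric_of_diag_eq_zero (K := ℂ)
    (fun a b c d => cupFour a b c d - (B a b * B c d + B a c * B b d + B a d * B b c) • P)
    ?_ ?_ ?_ ?_ ?_ ?_ a b c d
  · intro a a' b c d
    simp only [cupFour_add, hBadd]
    module
  · intro t a b c d
    simp only [cupFour_smul, hBsmul]
    module
  · intro a b c d
    rw [cupFour_swap12, hBc a b, hBc a c, hBc b c, hBc a d, hBc b d]
    module
  · intro a b c d
    rw [cupFour_swap23, hBc b c]
    module
  · intro a b c d
    rw [cupFour_swap34, hBc c d]
    module
  · intro a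
    rw [← cupPowTwo_four, h.cupPowTwo_eq a, doubleFactorial_K3HilbertSquare, sub_eq_zero]
    simp only [hB]
    norm_num
    ring_nf

/-- The polarised Fujiki relation in the consumer's literal spelling
`((a ∪ b) ∪ c) ∪ d = cupProduct (2·3+2=2·4) (cupProduct (2·2+2=2·3) (cupProduct (2+2=2·2) a b) c) d`
(ROUTE-P1D-Sketch §14b `polarisedFujiki_K3Sq2Type`, VERBATIM body).
[cite: OGrady2008NumericalK3Square, §2.2 Remark 2.1] [cite: Novario2026HodgeClassesHilbertSquares, Prop. 4.2 (p. 4)] -/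
theorem cupProduct_cupProduct_cupProduct_eq_of_isMarkedK3Hilb
    {φ : complexBetti X 2 ≃ₗ[ℂ] (K3HilbertIndex → ℂ)} {P : complexBetti X (2 * (2 * 2))}
    (h : IsMarkedK3Hilb 2 X φ P) (a b c d : complexBetti X 2) :
    cupProduct (rfl : 2 * 3 + 2 = 2 * 4)
        (cupProduct (rfl : 2 * 2 + 2 = 2 * 3) (cupProduct (rfl : 2 + 2 = 2 * 2) a b) c) d =
      (k3HilbertForm 2 (φ a) (φ b) * k3HilbertForm 2 (φ c) (φ d) +
        k3HilbertForm 2 (φ a) (φ c) * k3HilbertForm 2 (φ b) (φ d) +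
        k3HilbertForm 2 (φ a) (φ d) * k3HilbertForm 2 (φ b) (φ c)) • P :=
  cupFour_eq_of_isMarkedK3Hilb h a b c d

end CupFour

/-! ### §4 O'Grady's dual Beauville–Bogomolov class `q^∨` — DEFINITION, rationality, `⟨q^∨,αβ⟩ = 25(α,β)` -/

section DualClass

variable {X : Motives.SchemeOver ℂ}

/-- The inverse Gram matrix `(mᵢⱼ) = (gᵢⱼ)⁻¹ ∈ M₂₃(ℚ)` of the `K3^{[n]}` lattice `Λₙ` (O'Grady:
"`(mᵢⱼ) = (gᵢⱼ)⁻¹`"; for `n = 2`, `det Λ₂ = 2`, so `m ∈ ½ M₂₃(ℤ)`; Mathlib's `⁻¹` is the adjugate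
divided by the determinant, the honest inverse as `det Λₙ = 2n − 2 ≠ 0` for `n ≥ 2`, junk `0` at `n = 1`).
[cite: OGrady2008NumericalK3Square, §3 (the dual form q^∨, (mᵢⱼ) = (gᵢⱼ)⁻¹)] -/
def k3HilbertGramInv (n : ℕ) : Matrix K3HilbertIndex K3HilbertIndex ℚ :=
  ((k3HilbertGram n).map (Int.cast : ℤ → ℚ))⁻¹

/-- `m · g = 1` over `ℚ` for `n = 2` (`det Λ₂ = 2 ≠ 0`). [cite: OGrady2008NumericalK3Square, §3 ((mᵢⱼ) = (gᵢⱼ)⁻¹)] -/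
theorem k3HilbertGramInv_two_mul :
    k3HilbertGramInv 2 * (k3HilbertGram 2).map (Int.cast : ℤ → ℚ) = 1 := by
  refine Matrix.nonsing_inv_mul _ (isUnit_iff_ne_zero.mpr ?_)
  rw [← Int.cast_det, k3HilbertGram_two_det]
  norm_num

/-- `m · g = 1` read in `M₂₃(ℂ)`. [cite: OGrady2008NumericalK3Square, §3 ((mᵢⱼ) = (gᵢⱼ)⁻¹)] -/
theorem k3HilbertGramInv_two_mul_complex :
    (k3HilbertGramInv 2).map (Rat.cast : ℚ → ℂ) * (k3HilbertGram 2).map (Int.cast : ℤ → ℂ) = 1 := by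
  have h := congrArg (fun M : Matrix K3HilbertIndex K3HilbertIndex ℚ => M.map (Rat.castHom ℂ))
    k3HilbertGramInv_two_mul
  simp only [Matrix.map_mul, Matrix.map_map] at h
  rw [Matrix.map_one _ (map_zero _) (map_one _)] at h
  convert h using 2
  · simp only [Rat.coe_castHom]
  · ext i j
    simp only [Matrix.map_apply, Function.comp_apply, Rat.coe_castHom, Rat.cast_intCast]

/-- `tr(m · g) = 23`, written as the double sum `Σᵢⱼ mᵢⱼ gᵢⱼ` (`g` symmetric).
[cite: OGrady2008NumericalK3Square, §3 proof of Claim 3.1 (⟨q^∨,q^∨⟩ = 25·23; arXiv numbering, journal Prop. 2.2)] -/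
theorem sum_sum_k3HilbertGramInv_mul_k3HilbertGram :
    ∑ i, ∑ j, ((k3HilbertGramInv 2 i j : ℚ) : ℂ) * (k3HilbertGram 2 i j : ℂ) = 23 := by
  have h := congrArg Matrix.trace k3HilbertGramInv_two_mul_complex
  rw [Matrix.trace_one, card_k3HilbertIndex, Nat.cast_ofNat] at h
  rw [← h, Matrix.trace]
  refine Finset.sum_congr rfl fun i _ => ?_
  rw [Matrix.diag_apply, Matrix.mul_apply]
  refine Finset.sum_congr rfl fun j _ => ?_
  rw [Matrix.map_apply, Matrix.map_apply, k3HilbertGram_apply_comm 2 j i]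

/-- `Σᵢⱼ mᵢⱼ (g v)ᵢ (g w)ⱼ = vᵀ g m g w = vᵀ g w = (v.w)`: the contraction of `m = g⁻¹` against two
vectors paired through `g`. [cite: OGrady2008NumericalK3Square, §3 proof of Claim 3.1 (⟨q^∨,αβ⟩ = 25(α,β); arXiv numbering, journal Prop. 2.2)] -/
theorem sum_sum_k3HilbertGramInv_mul_mulVec_mul_mulVec (v w : K3HilbertIndex → ℂ) :
    ∑ i, ∑ j, ((k3HilbertGramInv 2 i j : ℚ) : ℂ) *
        (((k3HilbertGram 2).map (Int.cast : ℤ → ℂ) *ᵥ v) i *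
          ((k3HilbertGram 2).map (Int.cast : ℤ → ℂ) *ᵥ w) j) = k3HilbertForm 2 v w := by
  set G : Matrix K3HilbertIndex K3HilbertIndex ℂ := (k3HilbertGram 2).map (Int.cast : ℤ → ℂ) with hG
  set M : Matrix K3HilbertIndex K3HilbertIndex ℂ := (k3HilbertGramInv 2).map (Rat.cast : ℚ → ℂ)
    with hM
  have hMG : M * G = 1 := k3HilbertGramInv_two_mul_complex
  have hc : ∀ i j, ((k3HilbertGramInv 2 i j : ℚ) : ℂ) = M i j := fun i j => rfl
  set x : K3HilbertIndex → ℂ := G *ᵥ v with hx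
  set y : K3HilbertIndex → ℂ := G *ᵥ w with hy
  calc ∑ i, ∑ j, ((k3HilbertGramInv 2 i j : ℚ) : ℂ) * (x i * y j)
      = x ⬝ᵥ (M *ᵥ y) := by
        simp only [hc, dotProduct, Matrix.mulVec, Finset.mul_sum]
        exact Finset.sum_congr rfl fun i _ => Finset.sum_congr rfl fun j _ => by ring
    _ = (G *ᵥ v) ⬝ᵥ w := by rw [hy, Matrix.mulVec_mulVec, hMG, Matrix.one_mulVec]
    _ = w ⬝ᵥ (G *ᵥ v) := dotProduct_comm _ _
    _ = k3HilbertForm 2 w v := (k3HilbertForm_eq_dotProduct 2 w v).symm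
    _ = k3HilbertForm 2 v w := k3HilbertForm_comm 2 w v

/-- **O'Grady's dual Beauville–Bogomolov class `q^∨ ∈ H⁴(X; ℚ)` read through a marking** (O'Grady
2008 §3: "`q^∨ := Π₂ ∘ Sym₂(L_q⁻¹)(q) ∈ Sym² H²(X)`. Explicitly: let `{α₁,…,α₂₃}` be a basis of `H²(X)`
[…] `q = Σᵢⱼ gᵢⱼ αᵢ^∨ ⊗ αⱼ^∨` […] Then `q^∨ = Σᵢⱼ mᵢⱼ αᵢαⱼ`, `(mᵢⱼ) = (gᵢⱼ)⁻¹`"; Novario p. 4): for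
`φ : H²(X(ℂ);ℂ) ≃ Λₙ ⊗ ℂ` and the basis `αᵢ := φ⁻¹(eᵢ)`, whose Gram matrix for `q ∘ φ` is `Λₙ`,
`dualBBFClass n φ := Σᵢⱼ ((Λₙ ⊗ ℚ)⁻¹)ᵢⱼ • (αᵢ ∪ αⱼ) ∈ H⁴(X(ℂ); ℂ)`.  For a Beauville–Bogomolov marking
(`IsMarkedK3Hilb n X φ P`) `q ∘ φ = ± q_X` and this is `± q_X^∨`; meaningful for `n ≥ 2`.
[cite: OGrady2008NumericalK3Square, §3 (definition of q^∨)]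
[cite: Novario2026HodgeClassesHilbertSquares, §4 p. 4 (q_X^∨ = Σ mᵢⱼ eᵢeⱼ)] -/
def dualBBFClass (n : ℕ) (φ : complexBetti X 2 ≃ₗ[ℂ] (K3HilbertIndex → ℂ)) : complexBetti X (2 * 2) :=
  ∑ i, ∑ j, ((k3HilbertGramInv n i j : ℚ) : ℂ) •
    cupProduct (rfl : 2 + 2 = 2 * 2) (φ.symm (Pi.single i 1)) (φ.symm (Pi.single j 1))

/-- Unfolding of `dualBBFClass`. [cite: OGrady2008NumericalK3Square, §3 (definition of q^∨)] -/
theorem dualBBFClass_def (n : ℕ) (φ : complexBetti X 2 ≃ₗ[ℂ] (K3HilbertIndex → ℂ)) :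
    dualBBFClass n φ = ∑ i, ∑ j, ((k3HilbertGramInv n i j : ℚ) : ℂ) •
      cupProduct (rfl : 2 + 2 = 2 * 2) (φ.symm (Pi.single i 1)) (φ.symm (Pi.single j 1)) := rfl

/-- The marking basis `αᵢ = φ⁻¹(eᵢ)` consists of integral classes (clause (k2)).
[cite: Markman2024, §1.3 Step 1] -/
theorem isIntegralClass_symm_single {n : ℕ} {φ : complexBetti X 2 ≃ₗ[ℂ] (K3HilbertIndex → ℂ)}
    {P : complexBetti X (2 * (2 * n))} (h : IsMarkedK3Hilb n X φ P) (i : K3HilbertIndex) :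
    IsIntegralClass (φ.symm (Pi.single i 1)) := by
  refine (h.isIntegralClass_iff _).mpr ⟨Pi.single i 1, ?_⟩
  rw [LinearEquiv.apply_symm_apply]
  funext k
  by_cases hk : k = i
  · subst hk; simp
  · simp [Pi.single_eq_of_ne hk]

/-- A finite sum of rational classes is rational. [cite: HatcherAT2002, §3.1 p. 198] -/
theorem isRationalClass_sum {Y : Type} [TopologicalSpace Y] {k : ℕ} {ι : Type*} (s : Finset ι)
    {b : ι → singularCohomology ℂ ℂ Y k} (hb : ∀ j ∈ s, IsRationalClass (b j)) :
    IsRationalClass (∑ j ∈ s, b j) := by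
  classical
  induction s using Finset.induction_on with
  | empty => simpa using IsRationalClass.zero
  | insert a s ha ih =>
    rw [Finset.sum_insert ha]
    exact (hb a (Finset.mem_insert_self a s)).add (ih fun j hj => hb j (Finset.mem_insert_of_mem hj))

/-- **`q^∨` is a rational class**: the `αᵢ` are integral (k2), cup products and `ℚ`-combinations of
rational classes are rational (O'Grady: "`q^∨` is rational of type `(2,2)`"; Novario Prop. 4.4
"`q_X^∨ ∈ H^{2,2}(X, ℚ)`"). PROVED. [cite: OGrady2008NumericalK3Square, §3 proof of Claim 3.1]
[cite: Novario2026HodgeClassesHilbertSquares, Prop. 4.4 (p. 4)] -/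
theorem isRationalClass_dualBBFClass {n : ℕ} {φ : complexBetti X 2 ≃ₗ[ℂ] (K3HilbertIndex → ℂ)}
    {P : complexBetti X (2 * (2 * n))} (h : IsMarkedK3Hilb n X φ P) :
    IsRationalClass (dualBBFClass n φ) := by
  refine isRationalClass_sum _ fun i _ => isRationalClass_sum _ fun j _ => ?_
  exact ((isIntegralClass_symm_single h i).isRationalClass.cup _
    (isIntegralClass_symm_single h j).isRationalClass).smul _

/-- **O'Grady's identity `⟨q^∨, αβ⟩ = 25 (α,β)` (2008, proof of Claim 3.1; Novario Prop. 4.3), PROVED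
on a marked `K3^{[2]}`-type fourfold:** `(q^∨ ∪ a) ∪ b = 25·q(φa,φb)·P` for all `a, b ∈ H²(X(ℂ);ℂ)`.
Proof (print's "From Remark 2.1 one gets"): by the polarised Fujiki relation
`⟨αᵢαⱼ, ab⟩ = gᵢⱼ(a,b) + (αᵢ,a)(αⱼ,b) + (αᵢ,b)(αⱼ,a)`, and `Σ mᵢⱼgᵢⱼ = 23`, `Σ mᵢⱼ(αᵢ,a)(αⱼ,b) = (a,b)`
(`m = g⁻¹`), so the total is `(23 + 1 + 1)(a,b)`.  In the consumer's spelling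
`cupProduct (2·2+2 = 2·3) q^∨ a`, `cupProduct (2·3+2 = 2·4) – b`.
[cite: OGrady2008NumericalK3Square, §3 Claim 3.1 (proof: ⟨q^∨,αβ⟩ = 25(α,β); arXiv numbering, journal Prop. 2.2)]
[cite: Novario2026HodgeClassesHilbertSquares, Prop. 4.3 (p. 4)] -/
theorem dualBBFClass_cup_cup {φ : complexBetti X 2 ≃ₗ[ℂ] (K3HilbertIndex → ℂ)}
    {P : complexBetti X (2 * (2 * 2))} (h : IsMarkedK3Hilb 2 X φ P) (a b : complexBetti X 2) :
    cupProduct (rfl : 2 * 3 + 2 = 2 * 4) (cupProduct (rfl : 2 * 2 + 2 = 2 * 3) (dualBBFClass 2 φ) a) b =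
      ((25 : ℂ) * k3HilbertForm 2 (φ a) (φ b)) • P := by
  have hfour : ∀ i j : K3HilbertIndex,
      cupProduct (rfl : 2 * 3 + 2 = 2 * 4) (cupProduct (rfl : 2 * 2 + 2 = 2 * 3)
        (cupProduct (rfl : 2 + 2 = 2 * 2) (φ.symm (Pi.single i 1)) (φ.symm (Pi.single j 1))) a) b =
      ((k3HilbertGram 2 i j : ℂ) * k3HilbertForm 2 (φ a) (φ b) +
        ((k3HilbertGram 2).map (Int.cast : ℤ → ℂ) *ᵥ φ a) i *
          ((k3HilbertGram 2).map (Int.cast : ℤ → ℂ) *ᵥ φ b) j +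
        ((k3HilbertGram 2).map (Int.cast : ℤ → ℂ) *ᵥ φ b) i *
          ((k3HilbertGram 2).map (Int.cast : ℤ → ℂ) *ᵥ φ a) j) • P := by
    intro i j
    rw [← cupFour_def, cupFour_eq_of_isMarkedK3Hilb h, LinearEquiv.apply_symm_apply,
      LinearEquiv.apply_symm_apply, k3HilbertForm_single_single, k3HilbertForm_single_left,
      k3HilbertForm_single_left, k3HilbertForm_single_left, k3HilbertForm_single_left]
  simp only [dualBBFClass, map_sum, map_smul, LinearMap.sum_apply, LinearMap.smul_apply, hfour,
    smul_smul, ← Finset.sum_smul]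
  congr 1
  simp only [mul_add, Finset.sum_add_distrib]
  rw [sum_sum_k3HilbertGramInv_mul_mulVec_mul_mulVec, sum_sum_k3HilbertGramInv_mul_mulVec_mul_mulVec,
    k3HilbertForm_comm 2 (φ b)]
  have h23 : ∑ i, ∑ j, ((k3HilbertGramInv 2 i j : ℚ) : ℂ) *
      ((k3HilbertGram 2 i j : ℂ) * k3HilbertForm 2 (φ a) (φ b)) = 23 * k3HilbertForm 2 (φ a) (φ b) := by
    rw [← sum_sum_k3HilbertGramInv_mul_k3HilbertGram, Finset.sum_mul]
    refine Finset.sum_congr rfl fun i _ => ?_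
    rw [Finset.sum_mul]
    refine Finset.sum_congr rfl fun j _ => ?_
    ring
  rw [h23]
  ring

/-- **O'Grady's identity `⟨q^∨, q^∨⟩ = 23 · 25` (2008, proof of Claim 3.1; Novario Prop. 4.3), PROVED:**
`q^∨ ∪ q^∨ = 575·P` on a marked `K3^{[2]}`-type fourfold (`Σ mₖₗ ⟨q^∨, αₖαₗ⟩ = 25 Σ mₖₗ gₖₗ = 25·23`).
[cite: OGrady2008NumericalK3Square, §3 Claim 3.1 (proof: ⟨q^∨,q^∨⟩ = 25·23; arXiv numbering, journal Prop. 2.2)]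
[cite: Novario2026HodgeClassesHilbertSquares, Prop. 4.3 (p. 4)] -/
theorem dualBBFClass_cup_self {φ : complexBetti X 2 ≃ₗ[ℂ] (K3HilbertIndex → ℂ)}
    {P : complexBetti X (2 * (2 * 2))} (h : IsMarkedK3Hilb 2 X φ P) :
    cupProduct (rfl : 2 * 2 + 2 * 2 = 2 * 4) (dualBBFClass 2 φ) (dualBBFClass 2 φ) = (575 : ℂ) • P := by
  have hsplit : ∀ k l : K3HilbertIndex,
      cupProduct (rfl : 2 * 2 + 2 * 2 = 2 * 4) (dualBBFClass 2 φ)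
        (cupProduct (rfl : 2 + 2 = 2 * 2) (φ.symm (Pi.single k 1)) (φ.symm (Pi.single l 1))) =
      ((25 : ℂ) * (k3HilbertGram 2 k l : ℂ)) • P := by
    intro k l
    rw [← cupProduct_assoc (rfl : 2 * 2 + 2 = 2 * 3) (rfl : 2 + 2 = 2 * 2) (rfl : 2 * 3 + 2 = 2 * 4)
      (rfl : 2 * 2 + 2 * 2 = 2 * 4), dualBBFClass_cup_cup h, LinearEquiv.apply_symm_apply,
      LinearEquiv.apply_symm_apply, k3HilbertForm_single_single]
  set L := cupProduct (rfl : 2 * 2 + 2 * 2 = 2 * 4) (dualBBFClass 2 φ) with hL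
  rw [dualBBFClass_def 2 φ]
  simp only [map_sum, map_smul, hsplit, smul_smul, ← Finset.sum_smul]
  congr 1
  have h := sum_sum_k3HilbertGramInv_mul_k3HilbertGram
  calc ∑ i, ∑ j, ((k3HilbertGramInv 2 i j : ℚ) : ℂ) * (25 * (k3HilbertGram 2 i j : ℂ))
      = 25 * ∑ i, ∑ j, ((k3HilbertGramInv 2 i j : ℚ) : ℂ) * (k3HilbertGram 2 i j : ℂ) := by
        rw [Finset.mul_sum]
        refine Finset.sum_congr rfl fun i _ => ?_
        rw [Finset.mul_sum]
        refine Finset.sum_congr rfl fun j _ => ?_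
        ring
    _ = 575 := by rw [h]; norm_num

end DualClass

/-! ### §5 NAMED FACTS: Guan–Verbitsky (Betti numbers, `H⁴ = Sym² H²`) and O'Grady (`q^∨` algebraic) -/

/-- **Guan 2001, Main Theorem and Theorem 1, with Verbitsky 1996 (REFEREED): "If `M` is an irreducible
compact hyperkähler manifold of complex dimension `4`, then `3 ≤ b₂ ≤ 23`. Moreover, 1. if `b₂ = 23`,
then `b₃ = 0`. The Hodge diamond of `M` is the same as that of the Hilbert scheme of pairs of points on a
K3 surface" (so `b₄ = 276`); and (Verbitsky [main] Thm. 15.2, `i = n = 2`; O'Grady (2.1.4); Novario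
Prop. 4.1) "If equality holds then `b₃(X) = 0` and the map `Sym² H²(X, ℚ) → H⁴(X, ℚ)` induced by the cup
product is an isomorphism."**  Rendering (module docstring): for `X` a PROJECTIVE irreducible
symplectic variety of dimension `4` (`IsProjectiveIrreducibleSymplectic 4 X`): `3 ≤ b₂(X) ≤ 23`, and if
`b₂(X) = 23` then `b₃(X) = 0`, `b₄(X) = 276 (= dim Sym² ℚ²³)` and the `ℂ`-span of the cup products
`a ∪ b`, `a, b ∈ H²(X(ℂ);ℂ)`, is all of `H⁴(X(ℂ);ℂ)` (surjective + equal dimensions = the printed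
isomorphism, complexified).  Projective case of print — weaker, never stronger.  A published THEOREM
recorded as a named fact (unproved in the tree: Verbitsky's `so(4, b₂−2)`-action, Salamon's relation,
Guan's Riemann–Roch bound).
-- TODO(general form): compact hyperkähler (non-projective) fourfolds; the Hodge numbers h^{p,q}.
[cite: Guan2001BettiNumbersHyperkaehlerFourfolds, Main Theorem (p. 663) and Thm. 1 (p. 664–665)]
[cite: Verbitsky1996CohomologyGAFA, §1 (Thm. 15.2 of [main]: H^{2i}_r ≅ Sⁱ H² for i ≤ n)]
[cite: Novario2026HodgeClassesHilbertSquares, Prop. 4.1 (p. 4)] -/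
def Guan2001_betti_irreducibleSymplecticFourfold : Prop :=
  ∀ (X : Motives.SchemeOver ℂ), IsProjectiveIrreducibleSymplectic 4 X →
    3 ≤ Module.finrank ℂ (complexBetti X 2) ∧ Module.finrank ℂ (complexBetti X 2) ≤ 23 ∧
      (Module.finrank ℂ (complexBetti X 2) = 23 →
        Module.finrank ℂ (complexBetti X 3) = 0 ∧ Module.finrank ℂ (complexBetti X 4) = 276 ∧
          Submodule.span ℂ (Set.range fun ab : complexBetti X 2 × complexBetti X 2 ↦
            cupProduct (rfl : 2 + 2 = 4) ab.1 ab.2) = ⊤)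

/-- **Verbitsky–Guan for `K3^{[2]}`-type fourfolds (Novario Prop. 4.1 "In particular this happens when
`X` is an IHS fourfold of K3^[2]-type"; O'Grady 2008 (2.1.3)–(2.1.4): "In particular `b₂(M) = 23`; as is
well-known — see [Guan, Verbitsky] — this implies that `H³(M;ℚ) = 0`, `Sym² H²(M;ℚ) ⥲ H⁴(M;ℚ)`,
where the second isomorphism is given by cup-product") (REFEREED).**  Rendering: for every smooth
projective fourfold `X` of `K3^{[2]}`-type (`Motives.IsSmoothProjective 4 X ∧ IsOfK3HilbertSquareType X`):
`b₂(X) = 23`, `b₃(X) = 0`, `b₄(X) = 276` and the `ℂ`-span of `{a ∪ b : a, b ∈ H²(X(ℂ);ℂ)}` is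
`H⁴(X(ℂ);ℂ)` — i.e. `Sym² H²(X) → H⁴(X)` is an isomorphism (this is the route's request F-V
`VerbitskyGuan_H4_eq_symSq_H2`; `b₂ = 23` is Beauville's `H²(S^{[2]},ℤ) ≅ Λ`, a deformation invariant).
The cup product is spelled `cupProduct (rfl : 2 + 2 = 2 * 2)`, the consumer's.  A published THEOREM
recorded as a named fact.
[cite: Novario2026HodgeClassesHilbertSquares, Prop. 4.1 (p. 4)]
[cite: OGrady2008NumericalK3Square, §2.1 (2.1.3)–(2.1.4)]
[cite: Guan2001BettiNumbersHyperkaehlerFourfolds, Thm. 1 (p. 664)]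
[cite: Beauville1983, §6 Proposition 6 and §8 (b₂(S^{[2]}) = 23)] -/
def VerbitskyGuan_cohomology_K3HilbertSquareType : Prop :=
  ∀ (X : Motives.SchemeOver ℂ), Motives.IsSmoothProjective 4 X → IsOfK3HilbertSquareType X →
    Module.finrank ℂ (complexBetti X 2) = 23 ∧ Module.finrank ℂ (complexBetti X 3) = 0 ∧
      Module.finrank ℂ (complexBetti X (2 * 2)) = 276 ∧
        Submodule.span ℂ (Set.range fun ab : complexBetti X 2 × complexBetti X 2 ↦
          cupProduct (rfl : 2 + 2 = 2 * 2) ab.1 ab.2) = ⊤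

/-- **O'Grady 2008 §3 / Novario Prop. 4.4 (REFEREED): the dual Beauville–Bogomolov class is ALGEBRAIC,
and `(2/5) q^∨` is integral.**  Print: "`c₂(X) = 6q^∨/5` in `H⁴(X;ℚ)`" (O'Grady, proof of Prop. 3.2 (6)),
"`q^∨` is rational of type `(2,2)`" (proof of Claim 3.1), "`H⁴(X;ℤ)/Tors ∋ (2c₂(X) − 2q^∨) = 2q^∨/5`";
Novario Prop. 4.4: "`q_X^∨ ∈ H^{2,2}(X, ℚ)` […] and `(6/5) q_X^∨ = c₂(X) ∈ H^{2,2}(X, ℤ)`. Moreover,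
`(2/5) q_X^∨ ∈ H^{2,2}(X, ℤ)` is an integral Hodge class".  Since `c₂(X)` is a Chern class of an
algebraic vector bundle (the tangent bundle) on a smooth projective variety, `q^∨ = (5/6)c₂(X)` is an
ALGEBRAIC class (Fulton Prop. 19.1.2 / the field `ch_mem_algebraicClasses` of the tree's
`HodgeTheory.ChernCharacterBetti`) — the form the consumer uses (F-O "O'Grady's dual class `q^∨`
algebraic").  Rendering (module docstring): for every smooth projective fourfold `X` of `K3^{[2]}`-type
and every Beauville–Bogomolov marking `IsMarkedK3Hilb 2 X φ P`, the class `dualBBFClass 2 φ` (`= ±q_X^∨`)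
lies in `algebraicClasses X 2 = N² H⁴(X(ℂ);ℂ)` and `(2/5) • dualBBFClass 2 φ` is an integral class (both
clauses are invariant under the sign).  The relation `(6/5)q^∨ = c₂(T_X)` itself is not a clause (no
tangent sheaf on the tree's carriers; module docstring "Rendering").  A published THEOREM recorded as a
named fact (unproved in the tree: O'Grady's deformation argument + Hirzebruch–Riemann–Roch).
[cite: OGrady2008NumericalK3Square, §3 proof of Prop. 3.2 item (6) (c₂(X) = 6q^∨/5; 2q^∨/5 ∈ H⁴(X;ℤ)/Tors) and Claim 3.1]
[cite: Novario2026HodgeClassesHilbertSquares, Prop. 4.4 (p. 4)]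
[cite: Fulton1998, §19.1 Prop. 19.1.2 (Chern classes of algebraic bundles are algebraic)] -/
def OGrady2008_dualBBFClass_algebraic : Prop :=
  ∀ (X : Motives.SchemeOver ℂ), Motives.IsSmoothProjective 4 X → IsOfK3HilbertSquareType X →
    ∀ (φ : complexBetti X 2 ≃ₗ[ℂ] (K3HilbertIndex → ℂ)) (P : complexBetti X (2 * (2 * 2))),
      IsMarkedK3Hilb 2 X φ P →
        dualBBFClass 2 φ ∈ algebraicClasses X 2 ∧
          IsIntegralClass (((2 : ℂ) / 5) • dualBBFClass 2 φ)

/-! ### §6 Consequences for the consumer (kernel, modulo the facts they name) -/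

section Consequences

variable {X : Motives.SchemeOver ℂ}

/-- **F-O in the shape requested by the route** (ROUTE-P1D-Sketch §14b `OGrady_dualBBF_algebraic`,
VERBATIM conclusion): on a marked smooth projective `K3^{[2]}`-type fourfold there is a rational
ALGEBRAIC class `qd ∈ H⁴(X(ℂ);ℂ)` with `(qd ∪ a) ∪ b = 25·q(φa,φb)·P` for all `a, b` — namely `qd = q^∨`
(`dualBBFClass 2 φ`), by the fact `OGrady2008_dualBBFClass_algebraic` and the THEOREMS
`isRationalClass_dualBBFClass`, `dualBBFClass_cup_cup`.
[cite: OGrady2008NumericalK3Square, §3 Claim 3.1 and proof of Prop. 3.2 (6)]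
[cite: Novario2026HodgeClassesHilbertSquares, Props. 4.3–4.4 (p. 4)] -/
theorem OGrady2008_dualBBFClass_algebraic.exists_cup_cup_eq (hO : OGrady2008_dualBBFClass_algebraic)
    (hX : Motives.IsSmoothProjective 4 X) (hK : IsOfK3HilbertSquareType X)
    {φ : complexBetti X 2 ≃ₗ[ℂ] (K3HilbertIndex → ℂ)} {P : complexBetti X (2 * (2 * 2))}
    (h : IsMarkedK3Hilb 2 X φ P) :
    ∃ qd : complexBetti X (2 * 2), qd ∈ algebraicClasses X 2 ∧ IsRationalClass qd ∧
      ∀ a b : complexBetti X 2,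
        cupProduct (rfl : 2 * 3 + 2 = 2 * 4) (cupProduct (rfl : 2 * 2 + 2 = 2 * 3) qd a) b =
          ((25 : ℂ) * k3HilbertForm 2 (φ a) (φ b)) • P :=
  ⟨dualBBFClass 2 φ, (hO X hX hK φ P h).1, isRationalClass_dualBBFClass h, dualBBFClass_cup_cup h⟩

/-- `b₃ = 0` for a smooth projective `K3^{[2]}`-type fourfold, read off the fact; with hard Lefschetz
(tree theorem `finrank_complexBetti_eq_of_hardLefschetz`) also `b₅ = 0`.
[cite: Novario2026HodgeClassesHilbertSquares, Prop. 4.1 (p. 4)] [cite: VoisinHodgeI2002, Thm. 6.25] -/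
theorem VerbitskyGuan_cohomology_K3HilbertSquareType.finrank_complexBetti_five
    (hV : VerbitskyGuan_cohomology_K3HilbertSquareType) (hX : Motives.IsSmoothProjective 4 X)
    (hK : IsOfK3HilbertSquareType X) : Module.finrank ℂ (complexBetti X 5) = 0 := by
  rw [← finrank_complexBetti_eq_of_hardLefschetz hX (j := 1) (k := 3) (by norm_num) 5 (by norm_num)]
  exact (hV X hX hK).2.1

/-- `b₆ = b₂ = 23` for a smooth projective `K3^{[2]}`-type fourfold (fact + hard Lefschetz).
[cite: Novario2026HodgeClassesHilbertSquares, Prop. 4.1 (p. 4)] [cite: VoisinHodgeI2002, Thm. 6.25] -/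
theorem VerbitskyGuan_cohomology_K3HilbertSquareType.finrank_complexBetti_six
    (hV : VerbitskyGuan_cohomology_K3HilbertSquareType) (hX : Motives.IsSmoothProjective 4 X)
    (hK : IsOfK3HilbertSquareType X) : Module.finrank ℂ (complexBetti X 6) = 23 := by
  rw [← finrank_complexBetti_eq_of_hardLefschetz hX (j := 2) (k := 2) (by norm_num) 6 (by norm_num)]
  exact (hV X hX hK).1

/-- The general fact specialises to the `K3^{[2]}` statement once `X` is known to be projective
irreducible symplectic with `b₂ = 23` (how print derives Prop. 4.1's last sentence).
[cite: Novario2026HodgeClassesHilbertSquares, Prop. 4.1 (p. 4)]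
[cite: Guan2001BettiNumbersHyperkaehlerFourfolds, Thm. 1 (p. 664)] -/
theorem Guan2001_betti_irreducibleSymplecticFourfold.of_finrank_eq
    (hG : Guan2001_betti_irreducibleSymplecticFourfold) (hX : IsProjectiveIrreducibleSymplectic 4 X)
    (h23 : Module.finrank ℂ (complexBetti X 2) = 23) :
    Module.finrank ℂ (complexBetti X 3) = 0 ∧ Module.finrank ℂ (complexBetti X (2 * 2)) = 276 ∧
      Submodule.span ℂ (Set.range fun ab : complexBetti X 2 × complexBetti X 2 ↦
        cupProduct (rfl : 2 + 2 = 2 * 2) ab.1 ab.2) = ⊤ :=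
  (hG X hX).2.2 h23

/-! #### `H⁴ = Sym² H²` as a BASIS: the `276` classes `αᵢ ∪ αⱼ`, `{i,j} ∈ Sym²{1..23}` -/

/-- The family `{i, j} ↦ αᵢ ∪ αⱼ ∈ H⁴(X(ℂ);ℂ)` indexed by unordered pairs of lattice indices, for the
marking basis `αᵢ = φ⁻¹(eᵢ)` (well defined since degree-`2` classes commute) — the monomial basis of
`Sym² H²(X)` read in `H⁴(X)`. [cite: OGrady2008NumericalK3Square, §2.1 (2.1.4) (Sym² H² ⥲ H⁴)] -/
def symSqFamily (φ : complexBetti X 2 ≃ₗ[ℂ] (K3HilbertIndex → ℂ)) :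
    Sym2 K3HilbertIndex → complexBetti X (2 * 2) :=
  Sym2.lift ⟨fun i j => cupProduct (rfl : 2 + 2 = 2 * 2) (φ.symm (Pi.single i 1)) (φ.symm (Pi.single j 1)),
    fun _ _ => cupProduct_two_two_comm _ _⟩

/-- `symSqFamily φ {i, j} = αᵢ ∪ αⱼ`. [cite: OGrady2008NumericalK3Square, §2.1 (2.1.4)] -/
theorem symSqFamily_mk (φ : complexBetti X 2 ≃ₗ[ℂ] (K3HilbertIndex → ℂ)) (i j : K3HilbertIndex) :
    symSqFamily φ s(i, j) =
      cupProduct (rfl : 2 + 2 = 2 * 2) (φ.symm (Pi.single i 1)) (φ.symm (Pi.single j 1)) :=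
  rfl

/-- A class of `H²` expands in the marking basis: `a = Σᵢ (φa)ᵢ • αᵢ`. [cite: Markman2024, §1.3 Step 1] -/
theorem eq_sum_smul_symm_single (φ : complexBetti X 2 ≃ₗ[ℂ] (K3HilbertIndex → ℂ))
    (a : complexBetti X 2) : a = ∑ i, φ a i • φ.symm (Pi.single i 1) := by
  have h : φ a = ∑ i, φ a i • (Pi.single i (1 : ℂ) : K3HilbertIndex → ℂ) := by
    conv_lhs => rw [← Finset.univ_sum_single (φ a)]
    refine Finset.sum_congr rfl fun i _ => ?_
    rw [← Pi.single_smul', smul_eq_mul, mul_one]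
  calc a = φ.symm (φ a) := (φ.symm_apply_apply a).symm
    _ = φ.symm (∑ i, φ a i • (Pi.single i (1 : ℂ) : K3HilbertIndex → ℂ)) := by rw [← h]
    _ = ∑ i, φ a i • φ.symm (Pi.single i 1) := by simp only [map_sum, map_smul]

/-- Every cup product `a ∪ b` of degree-`2` classes lies in the span of the `αᵢ ∪ αⱼ` (bilinearity).
[cite: OGrady2008NumericalK3Square, §2.1 (2.1.4)] -/
theorem cupProduct_mem_span_symSqFamily (φ : complexBetti X 2 ≃ₗ[ℂ] (K3HilbertIndex → ℂ))
    (a b : complexBetti X 2) :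
    cupProduct (rfl : 2 + 2 = 2 * 2) a b ∈ Submodule.span ℂ (Set.range (symSqFamily φ)) := by
  have hmem : ∀ i j : K3HilbertIndex,
      cupProduct (rfl : 2 + 2 = 2 * 2) (φ.symm (Pi.single i 1)) (φ.symm (Pi.single j 1)) ∈
        Submodule.span ℂ (Set.range (symSqFamily φ)) :=
    fun i j => Submodule.subset_span ⟨s(i, j), symSqFamily_mk φ i j⟩
  rw [eq_sum_smul_symm_single φ a, eq_sum_smul_symm_single φ b]
  simp only [map_sum, map_smul, LinearMap.sum_apply, LinearMap.smul_apply]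
  refine Submodule.sum_mem _ fun i _ => Submodule.smul_mem _ _ (Submodule.sum_mem _ fun j _ =>
    Submodule.smul_mem _ _ (hmem _ _))

/-- If `H⁴` is spanned by cup products of degree-`2` classes, it is spanned by the `αᵢ ∪ αⱼ`.
[cite: OGrady2008NumericalK3Square, §2.1 (2.1.4)] -/
theorem span_symSqFamily_eq_top (φ : complexBetti X 2 ≃ₗ[ℂ] (K3HilbertIndex → ℂ))
    (hspan : Submodule.span ℂ (Set.range fun ab : complexBetti X 2 × complexBetti X 2 ↦
      cupProduct (rfl : 2 + 2 = 2 * 2) ab.1 ab.2) = ⊤) :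
    Submodule.span ℂ (Set.range (symSqFamily φ)) = ⊤ := by
  refine eq_top_iff.mpr ?_
  rw [← hspan]
  refine Submodule.span_le.mpr ?_
  rintro _ ⟨ab, rfl⟩
  exact cupProduct_mem_span_symSqFamily φ ab.1 ab.2

/-- `#Sym²{1,…,23} = C(24,2) = 276 = b₄`. [cite: Guan2001BettiNumbersHyperkaehlerFourfolds, Thm. 1 (p. 665: b₄ = 23·12 = 276)] -/
theorem card_sym2_k3HilbertIndex : Fintype.card (Sym2 K3HilbertIndex) = 276 := by
  rw [Sym2.card, card_k3HilbertIndex]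
  decide

/-- **`H⁴(X(ℂ);ℂ) = Sym² H²(X(ℂ);ℂ)` as a basis**: on a fourfold with `b₄ = 276` whose `H⁴` is spanned by
cup products of degree-`2` classes (the conclusions of `VerbitskyGuan_cohomology_K3HilbertSquareType`),
the `276` classes `αᵢ ∪ αⱼ`, `{i,j} ∈ Sym²`, read through any `φ : H² ≃ Λ ⊗ ℂ`, form a BASIS of `H⁴`
(`276` spanning vectors in dimension `276`) — the printed isomorphism `Sym² H² ⥲ H⁴` in coordinates.
[cite: OGrady2008NumericalK3Square, §2.1 (2.1.4)] [cite: Novario2026HodgeClassesHilbertSquares, Prop. 4.1 (p. 4)] -/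
def symSqBasis (φ : complexBetti X 2 ≃ₗ[ℂ] (K3HilbertIndex → ℂ))
    (h276 : Module.finrank ℂ (complexBetti X (2 * 2)) = 276)
    (hspan : Submodule.span ℂ (Set.range fun ab : complexBetti X 2 × complexBetti X 2 ↦
      cupProduct (rfl : 2 + 2 = 2 * 2) ab.1 ab.2) = ⊤) :
    Module.Basis (Sym2 K3HilbertIndex) ℂ (complexBetti X (2 * 2)) :=
  basisOfTopLeSpanOfCardEqFinrank (symSqFamily φ) (span_symSqFamily_eq_top φ hspan).ge
    (by rw [card_sym2_k3HilbertIndex, h276])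

/-- The basis vectors are the `αᵢ ∪ αⱼ`. [cite: OGrady2008NumericalK3Square, §2.1 (2.1.4)] -/
theorem symSqBasis_apply (φ : complexBetti X 2 ≃ₗ[ℂ] (K3HilbertIndex → ℂ))
    (h276 : Module.finrank ℂ (complexBetti X (2 * 2)) = 276)
    (hspan : Submodule.span ℂ (Set.range fun ab : complexBetti X 2 × complexBetti X 2 ↦
      cupProduct (rfl : 2 + 2 = 2 * 2) ab.1 ab.2) = ⊤) (i j : K3HilbertIndex) :
    symSqBasis φ h276 hspan s(i, j) =
      cupProduct (rfl : 2 + 2 = 2 * 2) (φ.symm (Pi.single i 1)) (φ.symm (Pi.single j 1)) := by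
  rw [symSqBasis, coe_basisOfTopLeSpanOfCardEqFinrank, symSqFamily_mk]

/-- **F-V as consumed**: on a smooth projective `K3^{[2]}`-type fourfold with a marking-type
identification `φ : H²(X(ℂ);ℂ) ≃ Λ ⊗ ℂ`, the classes `φ⁻¹eᵢ ∪ φ⁻¹eⱼ` (`{i,j} ∈ Sym²`) form a basis of
`H⁴(X(ℂ);ℂ)` — modulo the fact `VerbitskyGuan_cohomology_K3HilbertSquareType`.
[cite: Novario2026HodgeClassesHilbertSquares, Prop. 4.1 (p. 4)] [cite: OGrady2008NumericalK3Square, §2.1 (2.1.4)] -/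
def VerbitskyGuan_cohomology_K3HilbertSquareType.symSqBasis
    (hV : VerbitskyGuan_cohomology_K3HilbertSquareType) (hX : Motives.IsSmoothProjective 4 X)
    (hK : IsOfK3HilbertSquareType X) (φ : complexBetti X 2 ≃ₗ[ℂ] (K3HilbertIndex → ℂ)) :
    Module.Basis (Sym2 K3HilbertIndex) ℂ (complexBetti X (2 * 2)) :=
  Hyperkaehler.symSqBasis φ (hV X hX hK).2.2.1 (hV X hX hK).2.2.2

/-- The basis vectors of `VerbitskyGuan_cohomology_K3HilbertSquareType.symSqBasis` are the `αᵢ ∪ αⱼ`.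
[cite: Novario2026HodgeClassesHilbertSquares, Prop. 4.1 (p. 4)] -/
theorem VerbitskyGuan_cohomology_K3HilbertSquareType.symSqBasis_apply
    (hV : VerbitskyGuan_cohomology_K3HilbertSquareType) (hX : Motives.IsSmoothProjective 4 X)
    (hK : IsOfK3HilbertSquareType X) (φ : complexBetti X 2 ≃ₗ[ℂ] (K3HilbertIndex → ℂ))
    (i j : K3HilbertIndex) :
    hV.symSqBasis hX hK φ s(i, j) =
      cupProduct (rfl : 2 + 2 = 2 * 2) (φ.symm (Pi.single i 1)) (φ.symm (Pi.single j 1)) :=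
  Hyperkaehler.symSqBasis_apply φ _ _ i j

end Consequences

/-! ### §7 Bridge from the consumer's marking clauses (m1)–(m3) -/

section Bridge

variable {X : Motives.SchemeOver ℂ}

/-- **The route's marking clauses are a Beauville–Bogomolov marking.**  The clauses (m1)–(m3) of the
consumer's `MarkedK3Sq X φ P z` (route `MarkmanPartnerTransport`: `P` an integral generator of `H⁸`,
spelled `complexBetti X (2 * 4)`; `φ` identifies integral classes with `ℤ²³`; Fujiki `a⁴ = 3·q(φa)²·P`
with the literal constant `3` and `cupPowTwo a 4`) are exactly `IsMarkedK3Hilb 2 X φ P` (whose (k3)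
reads `cupPowTwo a (2·2) = (2·2−1)!! · q(φa)² · P`, `(2·2−1)!! = 3`), so every theorem and fact of this
file applies under the route's hypotheses by this one term. [cite: Markman2024, §1.3 Step 1]
[cite: Rapagnetta2007, Introduction (table: Fujiki constant 3 for K3^[2])] -/
theorem isMarkedK3Hilb_two_of_clauses {φ : complexBetti X 2 ≃ₗ[ℂ] (K3HilbertIndex → ℂ)}
    {P : complexBetti X (2 * 4)}
    (h1 : IsIntegralClass P ∧ ∀ Q : complexBetti X (2 * 4), IsIntegralClass Q → ∃ n : ℤ, Q = n • P)
    (h2 : ∀ c : complexBetti X 2, IsIntegralClass c ↔ ∃ v : K3HilbertIndex → ℤ, φ c = fun i => (v i : ℂ))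
    (h3 : ∀ a : complexBetti X 2,
      cupPowTwo a 4 = ((3 : ℂ) * (k3HilbertForm 2 (φ a) (φ a)) ^ 2) • P) :
    IsMarkedK3Hilb 2 X φ P := by
  refine ⟨h1, h2, fun a => ?_⟩
  rw [doubleFactorial_K3HilbertSquare]
  exact_mod_cast h3 a

/-- Conversely, a Beauville–Bogomolov marking `IsMarkedK3Hilb 2 X φ P` gives back the route's Fujiki
clause (m3) with the literal constant `3`. [cite: Rapagnetta2007, Introduction (table: Fujiki constant 3 for K3^[2])] -/
theorem IsMarkedK3Hilb.cupPowTwo_four_eq {φ : complexBetti X 2 ≃ₗ[ℂ] (K3HilbertIndex → ℂ)}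
    {P : complexBetti X (2 * (2 * 2))} (h : IsMarkedK3Hilb 2 X φ P) (a : complexBetti X 2) :
    cupPowTwo a 4 = ((3 : ℂ) * (k3HilbertForm 2 (φ a) (φ a)) ^ 2) • P := by
  have h3 := h.cupPowTwo_eq a
  rw [doubleFactorial_K3HilbertSquare] at h3
  exact_mod_cast h3

/-- **S-F under the route's hypotheses, literally**: the polarised Fujiki relation from the clauses
(m1)–(m3) of `MarkedK3Sq` (ROUTE-P1D-Sketch §14b `polarisedFujiki_K3Sq2Type`, whose binders are these).
[cite: OGrady2008NumericalK3Square, §2.2 Remark 2.1] [cite: Novario2026HodgeClassesHilbertSquares, Prop. 4.2 (p. 4)] -/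
theorem cupProduct_cupProduct_cupProduct_eq_of_clauses {φ : complexBetti X 2 ≃ₗ[ℂ] (K3HilbertIndex → ℂ)}
    {P : complexBetti X (2 * 4)}
    (h1 : IsIntegralClass P ∧ ∀ Q : complexBetti X (2 * 4), IsIntegralClass Q → ∃ n : ℤ, Q = n • P)
    (h2 : ∀ c : complexBetti X 2, IsIntegralClass c ↔ ∃ v : K3HilbertIndex → ℤ, φ c = fun i => (v i : ℂ))
    (h3 : ∀ a : complexBetti X 2,
      cupPowTwo a 4 = ((3 : ℂ) * (k3HilbertForm 2 (φ a) (φ a)) ^ 2) • P)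
    (a b c d : complexBetti X 2) :
    cupProduct (rfl : 2 * 3 + 2 = 2 * 4)
        (cupProduct (rfl : 2 * 2 + 2 = 2 * 3) (cupProduct (rfl : 2 + 2 = 2 * 2) a b) c) d =
      (k3HilbertForm 2 (φ a) (φ b) * k3HilbertForm 2 (φ c) (φ d) +
        k3HilbertForm 2 (φ a) (φ c) * k3HilbertForm 2 (φ b) (φ d) +
        k3HilbertForm 2 (φ a) (φ d) * k3HilbertForm 2 (φ b) (φ c)) • P :=
  cupFour_eq_of_isMarkedK3Hilb (isMarkedK3Hilb_two_of_clauses h1 h2 h3) a b c d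

/-- **F-O under the route's hypotheses, literally** (ROUTE-P1D-Sketch §14b `OGrady_dualBBF_algebraic`,
binders (m1)–(m3) of `MarkedK3Sq`, conclusion verbatim), modulo the fact
`OGrady2008_dualBBFClass_algebraic`. [cite: OGrady2008NumericalK3Square, §3 Claim 3.1 and proof of Prop. 3.2 (6)]
[cite: Novario2026HodgeClassesHilbertSquares, Props. 4.3–4.4 (p. 4)] -/
theorem OGrady2008_dualBBFClass_algebraic.exists_cup_cup_eq_of_clauses
    (hO : OGrady2008_dualBBFClass_algebraic) (hX : Motives.IsSmoothProjective 4 X)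
    (hK : IsOfK3HilbertSquareType X) {φ : complexBetti X 2 ≃ₗ[ℂ] (K3HilbertIndex → ℂ)}
    {P : complexBetti X (2 * 4)}
    (h1 : IsIntegralClass P ∧ ∀ Q : complexBetti X (2 * 4), IsIntegralClass Q → ∃ n : ℤ, Q = n • P)
    (h2 : ∀ c : complexBetti X 2, IsIntegralClass c ↔ ∃ v : K3HilbertIndex → ℤ, φ c = fun i => (v i : ℂ))
    (h3 : ∀ a : complexBetti X 2,
      cupPowTwo a 4 = ((3 : ℂ) * (k3HilbertForm 2 (φ a) (φ a)) ^ 2) • P) :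
    ∃ qd : complexBetti X (2 * 2), qd ∈ algebraicClasses X 2 ∧ IsRationalClass qd ∧
      ∀ a b : complexBetti X 2,
        cupProduct (rfl : 2 * 3 + 2 = 2 * 4) (cupProduct (rfl : 2 * 2 + 2 = 2 * 3) qd a) b =
          ((25 : ℂ) * k3HilbertForm 2 (φ a) (φ b)) • P :=
  hO.exists_cup_cup_eq hX hK (isMarkedK3Hilb_two_of_clauses h1 h2 h3)

end Bridge

end Literature.AlgebraicGeometry.Hyperkaehler

end
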